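import Literature.NumberTheory.GelbartRogawski1991.LocalUnitarySplittingDatum
import Literature.NumberTheory.Automorphic.Liu2021.LemD1DataOfPlace
import HarnessLib

/-!
# Rank-one theta lifts to `U(3)` from the two skew-hermitian LINES are disjoint (the `ε`-clause of [Liu2021, Lem. D.1 (3)] at `n = 3`) — ONE NAMED FACT

Topic `RepresentationTheory/MoeglinVignerasWaldspurger1987`; companion of `RankOneThetaLift.lean` (facts IV-1/IV-2),
`RankOneThetaLiftCentralCharacter.lean` (the `χ`-clause, PROVED) and `RankOneThetaLiftTwistRigidity.lean` (the
`μ`-clause, fact IV-4c3).  Row IV-4c1 of the Hodge/COR-CM interface (B-plan/B4-SPEC-IV4c-addendum.md §2, 2026-08-28), in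
the SECTION currency of those files at `N = 3`, with the second line modelled — as the tree models it — by a second
trace-zero element `δ₂` (`LemD1OfPlace.eps E v hδ : (E_v)ˣ` IS Step 1's representative `ε := δ ⊗ 1`, and the embedding
`iota F E c N hcδ hδ hd T hT hJ v : U(J)(F_v) → Sp(𝕎_v)` depends on the line through `δ`; the hermitian data `T`,
`J = T ⊗ 1`, the metaplectic-type group `LocalMp F 3 T v` and the subgroup `localPi E c 3 J v` are COMMON to both lines).

AS PRINTED. [Liu2021, App. D §D.1 Step 1] (l. 5217): «`ε` ranges over `E^{−×}/Nm_{E/F} E^×`» (two classes at a non-split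
place); [Lemma D.1 (3)] (l. 5233, p. 125): «(3) If `n ≥ 3`, then `ω(μ', ε', χ')` is isomorphic to `ω(μ, ε, χ)` if and
only if `(μ', ε', χ') = (μ, ε, χ)`.» with proof (l. 5255, p. 126) «For (3), it is known when `n = 3` by [GR90, Proposition
5.1.4].»  WHAT IS TYPED (the `ε`-clause): for two lines `δ₁, δ₂` in DIFFERENT classes (`δ₂ ≠ x xᶜ δ₁` for all
`x ∈ E_vˣ` — literally `¬ LemD1.SameClass` of the representatives `eps δ₁`, `eps δ₂`, see `sameClass_eps_iff`), ANY
splittings `s₁` over `ι_{δ₁}` and `s₂` over `ι_{δ₂}` and any unitary continuous `χ₁, χ₂`, a NON-ZERO `Θ_{s₁}(χ₁)` is never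
isomorphic to `Θ_{s₂}(χ₂)` as a representation of `U(J)(F_v)`.  For splittings of the same Kudla type this is THETA
DICHOTOMY / the CONSERVATION INEQUALITY for `Π := Θ_{s₁}(χ₁) ∈ Irr(U(V))` (irreducible by IV-1a): `Π` would occur at
dimension `1` in BOTH odd Witt towers of skew-hermitian spaces, whereas `n⁺(Π) + n⁻(Π) = 2·3 + 2 = 8`
([SunZhu2014, Thm. 1.10] «for any `π ∈ Irr(G(U))` … `n_{t₁}(π) + n_{t₂}(π) = 2 dim U + d`», held arXiv:1204.2969 chunk
p0006; lower bound for unitary pairs: Gong–Grenié 2011, [GanGrossPrasad2012]; [HarrisKudlaSweet1996, Cor. 4.4 p. 962]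
«at most one of the two theta lifts `Θ_χ(π, V±_m)` is non-zero» for `π` supercuspidal or off the boundary); across
splitting types it rests on [GelbartRogawski1990, Prop. 5.1.4]'s explicit list at `n = 3` (equivalently on the
L-parameters of rank-one lifts, [AtobeGan2017, Thms. 4.3/4.5]: the 2-dimensional block `χ_W ⊗ S₂` /
`χ_W(|·|^{1/2} ⊕ |·|^{-1/2})` is twisted by a change of type and detected at `n = 3`).  A named fact (D-0014), stated at
`N = 3` literally (the consumer `HypD3` is on a hermitian 3-space; the `n = 3` proof is the printed one).

Also PROVED here (consumer glue, no content): `LemD1OfPlace.eps_mem_skew_of` (a second trace-zero `δ₂` gives a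
representative in the standing data built from `δ₁`) and `sameClass_eps_iff` (the class relation `LemD1.SameClass` of
the two representatives is literally the units equation used in the fact).

## References
* [Liu2021] Y. Liu, Camb. J. Math. 9 (2021) = arXiv:2102.11518 — App. D §D.1 Step 1 (l. 5217), Lem. D.1 (3) (l. 5233)
  and proof (l. 5255).
* [GelbartRogawski1990] S. Gelbart, J. Rogawski, PS-Festschrift I (1990) 19–75 — Prop. 5.1.4 (NOT HELD; via [Liu2021]).
* [SunZhu2014] B. Sun, C.-B. Zhu, *Conservation relations for local theta correspondence*, J. AMS 28 (2015) — Thm. 1.10.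
* [HarrisKudlaSweet1996] M. Harris, S. Kudla, W. J. Sweet, *Theta dichotomy for unitary groups*, J. AMS 9 (1996) —
  Cor. 4.4 p. 962, Prop. 5.1 p. 964, Thm. 6.1 p. 967.
* [AtobeGan2017] H. Atobe, W. T. Gan, Invent. Math. 210 (2017) = arXiv:1602.01299 — Thms. 4.3/4.5.
* [MoeglinVignerasWaldspurger1987] MVW, LNM 1291, Chap. 3 §IV (rank-one type I pairs; currency of this folder).
-/

noncomputable section

namespace Literature.RepresentationTheory.MoeglinVignerasWaldspurger1987

open NumberField IsDedekindDomain
open scoped Matrix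
open Literature.RepresentationTheory.HeisenbergGroup (MpPsi)
open Literature.NumberTheory.GelbartRogawski1991.UnitaryDualPair.LocalSplitting (iota LocalMp localSchrodinger)
open Literature.NumberTheory.Automorphic (SchwartzBruhat UnitaryGroup.localPi UnitaryGroup.localCenter UnitaryGroup.LocalRing
  UnitaryGroup.localCenter_comm UnitaryGroup.conjLocal)
open Literature.NumberTheory.Automorphic.Liu2021 (AreIsomorphicRep LemD1.SameClass LemD1.EpsRep LemD1OfPlace.eps
  LemD1OfPlace.eps_mem_skew LemD1OfPlace.standingData)

/-- **[Liu2021, App. D Lem. D.1 (3)], `ε`-clause, at `n = 3` and a NON-SPLIT place** («if `n ≥ 3`, then `ω(μ', ε', χ')` is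
isomorphic to `ω(μ, ε, χ)` if and only if `(μ', ε', χ') = (μ, ε, χ)`», l. 5233; «known when `n = 3` by [GR90, Proposition
5.1.4]», l. 5255), READ AT THE TREE'S OBJECTS in the currency of `mvw_IV4_rankOne_irreducibleOrZero` with `N := 3` and TWO
LINES: for `F` a number field, `E/F` quadratic, `c`, trace-zero `δ₁, δ₂ ≠ 0` (`c δᵢ = -δᵢ`, `δᵢ² = dᵢ`) whose local
representatives `ε₁ = δ₁ ⊗ 1`, `ε₂ = δ₂ ⊗ 1 ∈ E_vˣ` (`LemD1OfPlace.eps`) lie in DIFFERENT classes of `E_v^{−×}/Nm E_vˣ`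
(`¬ ∃ x, ε₂ = x · xᶜ · ε₁`, `xᶜ = conjLocal x` — `LemD1.SameClass` unfolded, `sameClass_eps_iff`), `T ∈ M₃(F)` symmetric with
`det T` a unit, `J = T ⊗ 1`, a finite place `v` with `E_v` a field, splittings `s₁` over `ι_{δ₁}` and `s₂` over `ι_{δ₂}`
(`hsᵢ`) with `ω_{sᵢ} = (MpPsi.toRep (localSchrodinger F 3 T v)).comp sᵢ` smooth, a hermitian line `J₁` and unitary
continuous characters `χ₁, χ₂` of `U(J₁)(F_v) = E_v¹`: it is IMPOSSIBLE that the `χ₁`-coinvariants of `ω_{s₁}` under the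
centre are non-zero and `Θ_{s₁}(χ₁) ≅ Θ_{s₂}(χ₂)` as representations of `U(J)(F_v)` (`AreIsomorphicRep`) — «a non-zero
rank-one theta lift to `U(V)` from the line `W_{ε₁}` is never a rank-one theta lift from the line `W_{ε₂}` of the other
class».  A named fact (D-0014), not proved here; proof routes: theta dichotomy / conservation [SunZhu2014, Thm. 1.10;
HarrisKudlaSweet1996, Cor. 4.4] for equal splitting types, [GelbartRogawski1990, Prop. 5.1.4] (`n = 3`) in general.
[cite: Liu2021, App. D Lemma D.1 (3) (l. 5233) and proof l. 5255 (= GelbartRogawski1990 Prop. 5.1.4, n = 3)] -/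
def rankOne_theta_lines_disjoint : Prop :=
  ∀ (F : Type) [Field F] [NumberField F] (E : Type) [Field E] [NumberField E] [Algebra F E]
    [Algebra.IsQuadraticExtension F E] (c : E ≃ₐ[F] E)
    (δ₁ : E) (hcδ₁ : c δ₁ = -δ₁) (hδ₁ : δ₁ ≠ 0) (d₁ : F) (hd₁ : δ₁ * δ₁ = algebraMap F E d₁)
    (δ₂ : E) (hcδ₂ : c δ₂ = -δ₂) (hδ₂ : δ₂ ≠ 0) (d₂ : F) (hd₂ : δ₂ * δ₂ = algebraMap F E d₂)
    (T : Matrix (Fin 3) (Fin 3) F) (hT : T.IsSymm) (_hTd : IsUnit T.det)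
    (J : Matrix (Fin 3) (Fin 3) E) (hJ : J = T.map (algebraMap F E)) (v : HeightOneSpectrum (𝓞 F))
    (_hE : IsField (UnitaryGroup.LocalRing E v))
    (_hcls : ¬ ∃ x : (UnitaryGroup.LocalRing E v)ˣ,
      LemD1OfPlace.eps E v hδ₂ = x * Units.map (UnitaryGroup.conjLocal E c v : UnitaryGroup.LocalRing E v →* UnitaryGroup.LocalRing E v) x *
        LemD1OfPlace.eps E v hδ₁)
    (s₁ s₂ : UnitaryGroup.localPi E c 3 J v →* LocalMp F 3 T v)
    (_hs₁ : ∀ g, MpPsi.proj _ (s₁ g) = iota F E c 3 hcδ₁ hδ₁ hd₁ T hT hJ v g)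
    (_hs₂ : ∀ g, MpPsi.proj _ (s₂ g) = iota F E c 3 hcδ₂ hδ₂ hd₂ T hT hJ v g)
    (_hsm₁ : Representation.IsSmooth ((MpPsi.toRep (localSchrodinger F 3 T v)).comp s₁))
    (_hsm₂ : Representation.IsSmooth ((MpPsi.toRep (localSchrodinger F 3 T v)).comp s₂))
    (J₁ : Matrix (Fin 1) (Fin 1) E) (hJ₁ : J₁ 0 0 ≠ 0) (χ₁ χ₂ : UnitaryGroup.localPi E c 1 J₁ v →* ℂˣ)
    (_hχ₁u : ∀ z, ‖((χ₁ z : ℂˣ) : ℂ)‖ = 1) (_hχ₁c : Continuous fun z => ((χ₁ z : ℂˣ) : ℂ))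
    (_hχ₂u : ∀ z, ‖((χ₂ z : ℂˣ) : ℂ)‖ = 1) (_hχ₂c : Continuous fun z => ((χ₂ z : ℂˣ) : ℂ))
    (_hnt : Nontrivial (TwistedCoinv.Coinv
      ((show Representation ℂ (UnitaryGroup.localPi E c 1 J₁ v) (SchwartzBruhat (Fin 3 → v.adicCompletion F)) from
        ((MpPsi.toRep (localSchrodinger F 3 T v)).comp s₁).comp (UnitaryGroup.localCenter E c 3 J J₁ hJ₁ v))) χ₁))
    (_hiso : AreIsomorphicRep
      (TwistedCoinv.rep
        (ρW := show Representation ℂ (UnitaryGroup.localPi E c 1 J₁ v) (SchwartzBruhat (Fin 3 → v.adicCompletion F)) from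
          ((MpPsi.toRep (localSchrodinger F 3 T v)).comp s₁).comp (UnitaryGroup.localCenter E c 3 J J₁ hJ₁ v))
        χ₁ ((MpPsi.toRep (localSchrodinger F 3 T v)).comp s₁)
        (fun g z => (show Commute g (UnitaryGroup.localCenter E c 3 J J₁ hJ₁ v z) from
          UnitaryGroup.localCenter_comm E c 3 J J₁ hJ₁ v z g).map ((MpPsi.toRep (localSchrodinger F 3 T v)).comp s₁)))
      (TwistedCoinv.rep
        (ρW := show Representation ℂ (UnitaryGroup.localPi E c 1 J₁ v) (SchwartzBruhat (Fin 3 → v.adicCompletion F)) from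
          ((MpPsi.toRep (localSchrodinger F 3 T v)).comp s₂).comp (UnitaryGroup.localCenter E c 3 J J₁ hJ₁ v))
        χ₂ ((MpPsi.toRep (localSchrodinger F 3 T v)).comp s₂)
        (fun g z => (show Commute g (UnitaryGroup.localCenter E c 3 J J₁ hJ₁ v z) from
          UnitaryGroup.localCenter_comm E c 3 J J₁ hJ₁ v z g).map ((MpPsi.toRep (localSchrodinger F 3 T v)).comp s₂)))),
    False

/-! ### Consumer glue: the class hypothesis is `¬ LemD1.SameClass` of the two representatives -/

section Glue

variable {F : Type} [Field F] [NumberField F] (E : Type) [Field E] [NumberField E] [Algebra F E]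
  [Algebra.IsQuadraticExtension F E] (v : HeightOneSpectrum (𝓞 F)) (c : E ≃ₐ[F] E) (N : ℕ) (J : Matrix (Fin N) (Fin N) E)
  {δ₁ : E} (hcδ₁ : c δ₁ = -δ₁) (hδ₁ : δ₁ ≠ 0) (hN : 2 ≤ N) (hJh : (J.map c)ᵀ = J) (hJdet : J.det ≠ 0)
  {δ₂ : E} (hδ₂ : δ₂ ≠ 0)

/-- A second trace-zero `δ₂` gives a Step-1 representative `ε₂ = δ₂ ⊗ 1 ∈ E_v⁻` in the standing data built from `δ₁`
(the involution of the standing data is `c ⊗ 1` whatever `δ`). [cite: Liu2021, App. D §D.1 Step 1 (l. 5217)] -/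
theorem eps_mem_skew_of (hcδ₂ : c δ₂ = -δ₂) :
    ((LemD1OfPlace.eps E v hδ₂ : (UnitaryGroup.LocalRing E v)ˣ) : UnitaryGroup.LocalRing E v) ∈
      (LemD1OfPlace.standingData E v c N J hcδ₁ hδ₁ hN hJh hJdet).skew := by
  rw [Literature.RepresentationTheory.Liu2021.OscillatorStandingData.mem_skew_iff]
  change algebraMap E (UnitaryGroup.LocalRing E v) δ₂ + UnitaryGroup.conjLocal E c v (algebraMap E (UnitaryGroup.LocalRing E v) δ₂) = 0
  rw [Literature.NumberTheory.Automorphic.UnitaryGroup.conjLocal_algebraMap, hcδ₂, map_neg, add_neg_cancel]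

/-- **The class hypothesis of `rankOne_theta_lines_disjoint` is `¬ SameClass ε₁ ε₂`**: for the representatives
`ε₁ = δ₁ ⊗ 1`, `ε₂ = δ₂ ⊗ 1` of the standing data at `v`, `LemD1.SameClass ε₁ ε₂` (READING L3′: `ε₂ = x xᶜ ε₁` for some
`x ∈ E_vˣ`) is literally the units equation with `xᶜ = conjLocal x`. [cite: Liu2021, App. D §D.1 Step 1 (l. 5217)] -/
theorem sameClass_eps_iff (hcδ₂ : c δ₂ = -δ₂) :
    LemD1.SameClass (S := LemD1OfPlace.standingData E v c N J hcδ₁ hδ₁ hN hJh hJdet)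
        ⟨LemD1OfPlace.eps E v hδ₁, LemD1OfPlace.eps_mem_skew E v c N J hcδ₁ hδ₁ hN hJh hJdet⟩
        ⟨LemD1OfPlace.eps E v hδ₂, eps_mem_skew_of E v c N J hcδ₁ hδ₁ hN hJh hJdet hδ₂ hcδ₂⟩ ↔
      ∃ x : (UnitaryGroup.LocalRing E v)ˣ,
        LemD1OfPlace.eps E v hδ₂ = x * Units.map (UnitaryGroup.conjLocal E c v : UnitaryGroup.LocalRing E v →* UnitaryGroup.LocalRing E v) x *
          LemD1OfPlace.eps E v hδ₁ :=
  Iff.rfl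

end Glue

end Literature.RepresentationTheory.MoeglinVignerasWaldspurger1987

end
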